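import Summits.ResolutionOfSingularities.ResolutionOfSingularities.Theorems.HilbertSamuelEliminationCampaignW42ConeSemicontinuity
import Literature.AlgebraicGeometry.Resolution.BlowupFibreConeModel
import Literature.AlgebraicGeometry.Resolution.BennettDimOneSharp
import Literature.AlgebraicGeometry.Resolution.FiniteNormalizationGRing
import Literature.AlgebraicGeometry.Resolution.AffineDomainEquidim
import Literature.AlgebraicGeometry.Resolution.ExcellentRingsFieldProofs
import Mathlib.RingTheory.Jacobson.Ring
import HarnessLib

/-!
# [OURS · L1 W4.2] Ridge confinement at an ARBITRARY (non-closed) point of a cone: a prime `𝔓 ⊇ I` at which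
# Bennett's inequality `H⁽ᵈ⁾(𝒪_{C,𝔓}) ≤ H⁽⁰⁾(𝒪_{C,0})` is an equality lies on the ridge, `ridgeIdeal I ⊆ 𝔓`
# (campaign s42, cell res-hironaka; informal crux `RidgeConfinement`, stmt-ResolutionOfSingularities-17845; `--supports`)

HONEST FRAMING. OURS (slot W4.2, prover res-L1-s42-pv-1, gen 3). For a homogeneous ideal `I ⊆ S = K[X_1, …, X_n]` (any
field, any characteristic), `T = S/I`, the cone `C = Spec T` with vertex `0`, gen 2 proved (`…ConeRidgeClosedPoint`):
a CLOSED point `𝔮` of `C` that is near to the vertex (`H(S/I)⁽ⁿ⁺¹⁾ ≤ H⁽ⁿ⁺¹⁾(𝒪_{C,𝔮})`) lies on Giraud's ridge,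
`𝔉 = ridgeIdeal I ⊆ 𝔮`. This file extends it to EVERY point of the cone — the form in which a point `x'` of a blow-up,
read in the fibre cone `C_{X,D,x}` through the homogeneous prime of the line it spans, arrives (Bennett equality at
that prime, `…CampaignW42PermissibleNearEqualities.lean`):

* `isNear_closedPoint_of_hilbertFunQuot_le` — **Bennett propagation**: if a prime `𝔓 ⊇ I` with `dim S/𝔓 = d`
  satisfies `H(S/I) ≤ H⁽ᵈ⁾(𝒪_{C,𝔓})` (pointwise; i.e. EQUALITY in Bennett–Singh's `H⁽ᵈ⁾(𝒪_{C,𝔓}) ≤ H⁽⁰⁾(𝒪_{C,0})`),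
  then EVERY closed point `𝔮 ⊇ 𝔓` is near to the vertex: `H(S/I)⁽ⁿ⁺¹⁾ ≤ H⁽ⁿ⁺¹⁾(𝒪_{C,𝔮})`. Proof: Bennett's inequality
  in Singh's sharp form in the local ring `𝒪_{C,𝔮}` (a G-ring containing `K`; tree `BennettDimOneSharp.lean`) at the
  prime `𝔓𝒪_{C,𝔮}`, whose coheight is `ht(𝔮/𝔓) = dim S/𝔓 = d` by EQUIDIMENSIONALITY of the affine domain `S/𝔓`
  (tree `AffineDomainEquidim.lean`): `H(S/I)⁽ⁿ⁺¹⁾ ≤ H⁽ⁿ⁺¹⁺ᵈ⁾(𝒪_{C,𝔓}) ≤ H⁽ⁿ⁺¹⁾(𝒪_{C,𝔮})`.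
* `ridgeIdeal_le_of_forall_isMaximal` — **Jacobson step**: if `𝔉 ⊆ 𝔮` for every maximal `𝔮 ⊇ 𝔓` then `𝔉 ⊆ 𝔓`
  (`K[X]` is a Jacobson ring: a prime is the intersection of the maximal ideals above it).
* **`ridgeIdeal_le_of_hilbertFunQuot_le_hilbertSamuelFun`** — THE CONE THEOREM AT AN ARBITRARY POINT: `𝔓 ⊇ I` prime,
  `dim S/𝔓 = d`, `𝒪_{C,𝔓}` any localization of `T` at `𝔓/I`, `H(S/I) ≤ H⁽ᵈ⁾(𝒪_{C,𝔓})` ⟹ `ridgeIdeal I ⊆ 𝔓`: the point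
  `𝔓` lies on the ridge `F(C) = V(𝔉)` (scheme-theoretically: its closure does). With gen 2's closed-point theorem this is
  CJS Thm. 3.14 / Hironaka–Giraud «near points lie on the ridge» for ALL points of a cone, every residue field, every
  characteristic, ridge in place of directrix.

NOTHING here is a statement of H. Hironaka's manuscript [Hironaka2017]. AI review is weaker than expert review.
References (orientation only): V. Cossart, U. Jannsen, S. Saito, LNM 2270 (2020), Thm. 2.33 (Bennett–Singh), Thm. 3.14;
J. Giraud, Ann. Sci. ÉNS 8 (1975) §1.5; H. Matsumura, *Commutative Ring Theory*, Thm. 5.6 / Ex. 5.1.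
-/

noncomputable section

-- single-conjunct summit: the doubled namespace component `ResolutionOfSingularities` is mandated
set_option linter.dupNamespace false
-- quotients of localizations of `K[X]/I` (`𝒪_{C,𝔮}/𝔓𝒪_{C,𝔮}`) need one more level of nested instance synthesis
-- (`HasQuotient (Localization.AtPrime _) (Ideal _)` over an `MvPolynomial` quotient), as in parts of Mathlib
set_option maxSynthPendingDepth 3

open MvPolynomial IsLocalRing
open Literature.RingTheory.HilbertSamuel
open Literature.AlgebraicGeometry.Resolution

namespace Summit.ResolutionOfSingularities.ResolutionOfSingularities.Theorems

namespace CampaignW42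

universe u

variable {K : Type u} [Field K] {n : ℕ}

local notation3 "S" => MvPolynomial (Fin n) K

/-! ## Maximal ideals above a prime of the cone -/

/-- **Equidimensionality read above `𝔓`**: for a prime `𝔓` of `S = K[X]` with `dim S/𝔓 = d`, an ideal `I ⊆ 𝔓` and a
maximal `𝔮 ⊇ 𝔓`, the prime `𝔓·𝒪_{C,𝔮}` of the local ring `𝒪_{C,𝔮} = (S/I)_{𝔮/I}` has coheight `d`
(`= ht(𝔮/𝔓)`, all maximal ideals of the affine domain `S/𝔓` having height `dim S/𝔓`).
[cite: Matsumura1987, §5 Thm. 5.6 and Ex. 5.1] -/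
theorem ringKrullDim_localization_quotient_eq {I 𝔓 𝔮 : Ideal S} [𝔓.IsPrime] [𝔮.IsMaximal] (hI𝔓 : I ≤ 𝔓)
    (h𝔓𝔮 : 𝔓 ≤ 𝔮) {d : ℕ} (hd : ringKrullDim (S ⧸ 𝔓) = d) :
    haveI := isMaximal_map_mk_of_le ‹𝔮.IsMaximal› (hI𝔓.trans h𝔓𝔮)
    ringKrullDim (Localization.AtPrime (𝔮.map (Ideal.Quotient.mk I)) ⧸
      (𝔓.map (Ideal.Quotient.mk I)).map
        (algebraMap (S ⧸ I) (Localization.AtPrime (𝔮.map (Ideal.Quotient.mk I))))) = d := by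
  haveI := isMaximal_map_mk_of_le ‹𝔮.IsMaximal› (hI𝔓.trans h𝔓𝔮)
  haveI := isPrime_map_quotientMk_of_le hI𝔓
  rw [ringKrullDim_localization_quotient_map_map hI𝔓 (𝔮.map (Ideal.Quotient.mk I)) (Ideal.map_mono h𝔓𝔮)]
  -- the double quotient `(S/I)/(𝔓/I) ≅ S/𝔓` is an affine domain of dimension `d`
  set T := S ⧸ I
  set P' : Ideal T := 𝔓.map (Ideal.Quotient.mk I)
  haveI : IsDomain (T ⧸ P') := Ideal.Quotient.isDomain P'
  haveI : Algebra.FiniteType K (T ⧸ P') := inferInstance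
  haveI hmax : ((𝔮.map (Ideal.Quotient.mk I)).map (Ideal.Quotient.mk P')).IsMaximal := by
    have hsurj : Function.Surjective ((Ideal.Quotient.mk P').comp (Ideal.Quotient.mk I)) :=
      Ideal.Quotient.mk_surjective.comp Ideal.Quotient.mk_surjective
    rw [Ideal.map_map]
    refine (Ideal.map_eq_top_or_isMaximal_of_surjective _ hsurj ‹𝔮.IsMaximal›).resolve_left
      fun htop => ‹𝔮.IsMaximal›.ne_top ?_
    have h := Ideal.comap_map_of_surjective _ hsurj 𝔮
    have hker : RingHom.ker ((Ideal.Quotient.mk P').comp (Ideal.Quotient.mk I)) = 𝔓 := by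
      rw [← RingHom.comap_ker, Ideal.mk_ker, Ideal.comap_map_of_surjective _ Ideal.Quotient.mk_surjective,
        ← RingHom.ker_eq_comap_bot, Ideal.mk_ker, sup_eq_left.mpr hI𝔓]
    rw [htop, Ideal.comap_top, ← RingHom.ker_eq_comap_bot, hker, sup_eq_left.mpr h𝔓𝔮] at h
    exact h.symm
  rw [height_eq_ringKrullDim_of_isMaximal K ((𝔮.map (Ideal.Quotient.mk I)).map (Ideal.Quotient.mk P')),
    ringKrullDim_eq_of_ringEquiv (DoubleQuot.quotQuotEquivQuotOfLE hI𝔓), hd]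

/-- The local rings of the cone `C = Spec(S/I)` are G-rings (localizations of an algebra of finite type over `K`).
[cite: StacksProject, Tag 07QW] -/
theorem isGRing_localization_cone (I : Ideal S) (𝔮 : Ideal (S ⧸ I)) [𝔮.IsPrime] :
    IsGRing (Localization.AtPrime 𝔮) :=
  isGRing_of_isLocalization 𝔮.primeCompl (isQuasiExcellentRing_of_finiteType_field K (S ⧸ I)).isGRing

/-! ## Bennett propagation: closed points above a Bennett-near prime are near -/

/-- **Bennett propagation.** Let `I ⊆ 𝔓 ⊆ S = K[X_1, …, X_n]`, `𝔓` prime with `dim S/𝔓 = d`, `L = 𝒪_{C,𝔓}` a localization of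
`S/I` at `𝔓/I`, and assume `H(S/I) ≤ H⁽ᵈ⁾(L)` pointwise (equality in Bennett–Singh's inequality `H⁽ᵈ⁾(𝒪_{C,𝔓}) ≤
H⁽⁰⁾(𝒪_{C,0}) = H(S/I)`). Then every closed point `𝔮 ⊇ 𝔓` of the cone is NEAR to the vertex:
`H(S/I)⁽ⁿ⁺¹⁾ ≤ H⁽ⁿ⁺¹⁾(𝒪_{C,𝔮})` — by Bennett's inequality in `𝒪_{C,𝔮}` at `𝔓𝒪_{C,𝔮}` (coheight `d` by
equidimensionality). [cite: CossartJannsenSaito2020, Thm. 2.33 (1)] -/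
theorem iterPSum_hilbertFunQuot_le_of_le_hilbertSamuelFun {I 𝔓 𝔮 : Ideal S} [𝔓.IsPrime] [𝔮.IsMaximal] (hI𝔓 : I ≤ 𝔓)
    (h𝔓𝔮 : 𝔓 ≤ 𝔮) {d : ℕ} (hd : ringKrullDim (S ⧸ 𝔓) = d)
    (L : Type u) [CommRing L] [Algebra (S ⧸ I) L] [IsLocalRing L]
    [haveI := isPrime_map_quotientMk_of_le hI𝔓; IsLocalization.AtPrime L (𝔓.map (Ideal.Quotient.mk I))]
    (h : hilbertFunQuot K n I ≤ hilbertSamuelFun L d) :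
    haveI := isMaximal_map_mk_of_le ‹𝔮.IsMaximal› (hI𝔓.trans h𝔓𝔮)
    iterPSum (n + 1) (hilbertFunQuot K n I) ≤
      hilbertSamuelFun (Localization.AtPrime (𝔮.map (Ideal.Quotient.mk I))) (n + 1) := by
  haveI h𝔮' := isMaximal_map_mk_of_le ‹𝔮.IsMaximal› (hI𝔓.trans h𝔓𝔮)
  haveI h𝔓' := isPrime_map_quotientMk_of_le hI𝔓
  set T := S ⧸ I
  set P' : Ideal T := 𝔓.map (Ideal.Quotient.mk I) with hP'
  set Q' : Ideal T := 𝔮.map (Ideal.Quotient.mk I) with hQ'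
  set R := Localization.AtPrime Q'
  have hPQ : P' ≤ Q' := Ideal.map_mono h𝔓𝔮
  haveI hp := isPrime_map_localization_atPrime_of_le Q' hPQ
  set p : Ideal R := P'.map (algebraMap T R) with hp_def
  haveI : IsNoetherianRing R := IsLocalization.isNoetherianRing Q'.primeCompl R inferInstance
  haveI : IsNoetherianRing L := IsLocalization.isNoetherianRing P'.primeCompl L inferInstance
  -- Bennett–Singh in `R = 𝒪_{C,𝔮}` at `p = 𝔓 R`, `dim R/p = d`
  have hG : IsGRing R := isGRing_localization_cone I Q'
  have hdim : ringKrullDim (R ⧸ p) = d := ringKrullDim_localization_quotient_eq hI𝔓 h𝔓𝔮 hd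
  have hB : ∀ s', hilbertSamuelFun (Localization.AtPrime p) (s' + d) ≤ hilbertSamuelFun R s' :=
    hilbertSamuelFun_add_le_of_ringKrullDim_quotient_eq_of_ringHom_field
      ((algebraMap T R).comp (algebraMap K T)) (fun q' Q _ _ hqQ hadj _ =>
        module_finite_integralClosure_range_localization_quotient_of_isGRing hG Q _
          (ringKrullDim_localization_quotient_map_eq_one hqQ hadj)) d p hdim
  -- `R_p ≅ L`: both are localizations of `T` at `𝔓/I`
  haveI := isLocalization_atPrime_localization_map_of_le Q' hPQ
  have e : Localization.AtPrime p ≃+* L :=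
    (IsLocalization.algEquiv P'.primeCompl (Localization.AtPrime p) L).toRingEquiv
  have hB' : hilbertSamuelFun L ((n + 1) + d) ≤ hilbertSamuelFun R (n + 1) := by
    rw [← hilbertSamuelFun_congr_ringEquiv e]
    exact hB (n + 1)
  calc iterPSum (n + 1) (hilbertFunQuot K n I)
      ≤ iterPSum (n + 1) (hilbertSamuelFun L d) := iterPSum_mono (n + 1) h
    _ = hilbertSamuelFun L ((n + 1) + d) := iterPSum_hilbertSamuelFun L (n + 1) d
    _ ≤ hilbertSamuelFun R (n + 1) := hB'

/-! ## The Jacobson step and the cone theorem at an arbitrary point -/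

/-- **Jacobson step**: if the ridge ideal lies in every maximal ideal above the prime `𝔓`, it lies in `𝔓` (`K[X]` is a
Jacobson ring). [folklore] -/
theorem ridgeIdeal_le_of_forall_isMaximal {I 𝔓 : Ideal S} [𝔓.IsPrime]
    (h : ∀ 𝔮 : Ideal S, 𝔮.IsMaximal → 𝔓 ≤ 𝔮 → ridgeIdeal I ≤ 𝔮) : ridgeIdeal I ≤ 𝔓 := by
  have hJ : 𝔓.jacobson = 𝔓 := IsJacobsonRing.out inferInstance (Ideal.IsPrime.isRadical ‹_›)
  rw [← hJ]
  exact le_sInf fun 𝔮 ⟨h𝔓𝔮, h𝔮⟩ => h 𝔮 h𝔮 h𝔓𝔮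

/-- **THE CONE THEOREM AT AN ARBITRARY POINT (ridge confinement, every characteristic, every residue field).** For a
homogeneous ideal `I ⊆ S = K[X_1, …, X_n]`, a prime `𝔓 ⊇ I` with `dim S/𝔓 = d`, and any localization `L = 𝒪_{C,𝔓}` of
`S/I` at `𝔓/I`: if `H(S/I) ≤ H⁽ᵈ⁾(𝒪_{C,𝔓})` pointwise (EQUALITY in Bennett–Singh's `H⁽ᵈ⁾(𝒪_{C,𝔓}) ≤ H⁽⁰⁾(𝒪_{C,0})`:
the point `𝔓` of the cone `C = V(I)` is near to the vertex), then `ridgeIdeal I ⊆ 𝔓`, i.e. `𝔓 ∈ V(𝔉) = F(C)`,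
Giraud's ridge. (Closed points: gen 2's `ridgeIdeal_le_of_isMaximal`; here: every closed point above `𝔓` is near by
Bennett propagation, and `𝔓` is the intersection of those.) [cite: CossartJannsenSaito2020, Thm. 3.14] -/
theorem ridgeIdeal_le_of_hilbertFunQuot_le_hilbertSamuelFun {I 𝔓 : Ideal S} (hI : IsHomogeneousIdeal I) [𝔓.IsPrime]
    (hI𝔓 : I ≤ 𝔓) {d : ℕ} (hd : ringKrullDim (S ⧸ 𝔓) = d)
    (L : Type u) [CommRing L] [Algebra (S ⧸ I) L] [IsLocalRing L]
    [haveI := isPrime_map_quotientMk_of_le hI𝔓; IsLocalization.AtPrime L (𝔓.map (Ideal.Quotient.mk I))]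
    (h : hilbertFunQuot K n I ≤ hilbertSamuelFun L d) : ridgeIdeal I ≤ 𝔓 := by
  refine ridgeIdeal_le_of_forall_isMaximal fun 𝔮 h𝔮 h𝔓𝔮 => ?_
  haveI := h𝔮
  haveI := isMaximal_map_mk_of_le h𝔮 (hI𝔓.trans h𝔓𝔮)
  exact ridgeIdeal_le_of_isMaximal hI (hI𝔓.trans h𝔓𝔮)
    (iterPSum_hilbertFunQuot_le_of_le_hilbertSamuelFun hI𝔓 h𝔓𝔮 hd L h)

/-- The same with the Hilbert–Samuel functions `H⁽ᵗ⁾`: `H(S/I)⁽ᵗ⁾ ≤ H⁽ᵗ⁺ᵈ⁾(𝒪_{C,𝔓})` for some `t` suffices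
(`ν ↦ ν⁽ᵗ⁾` reflects `≤`... no: it PRESERVES equality, and equality is what a near point delivers —
`H⁽ᵗ⁺ᵈ⁾(𝒪_{C,𝔓}) = H(S/I)⁽ᵗ⁾`). [cite: CossartJannsenSaito2020, Thm. 3.14] -/
theorem ridgeIdeal_le_of_hilbertSamuelFun_eq {I 𝔓 : Ideal S} (hI : IsHomogeneousIdeal I) [𝔓.IsPrime]
    (hI𝔓 : I ≤ 𝔓) {d : ℕ} (hd : ringKrullDim (S ⧸ 𝔓) = d)
    (L : Type u) [CommRing L] [Algebra (S ⧸ I) L] [IsLocalRing L]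
    [haveI := isPrime_map_quotientMk_of_le hI𝔓; IsLocalization.AtPrime L (𝔓.map (Ideal.Quotient.mk I))]
    {t : ℕ} (h : hilbertSamuelFun L (t + d) = iterPSum t (hilbertFunQuot K n I)) : ridgeIdeal I ≤ 𝔓 := by
  refine ridgeIdeal_le_of_hilbertFunQuot_le_hilbertSamuelFun hI hI𝔓 hd L (le_of_eq ?_)
  rw [← iterPSum_hilbertSamuelFun L t d] at h
  exact (iterPSum_injective t h).symm

end CampaignW42

end Summit.ResolutionOfSingularities.ResolutionOfSingularities.Theorems

end
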